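import Literature.Topology.FourManifolds.GaussDiagramsStabilityWindow
import HarnessLib

/-!
# Readings modulo designated double points, and inserting a chord into a reading

Companion of `GaussDiagramsStabilityWindow.lean`, towards the named fact
`Literature.Topology.FourManifolds.Knot.reidemeisterR` (direction `→`): the **combinatorial
layer** of the analysis of the elementary events. After an event, the stability relative to the
window (`IsRegularReadingOff.eventually_exists`) hands over a reading of the OLD chords in which
the double points inside the window are not yet listed; the analysis inside the window describes
those as finitely many designated pairs of parameters (two for the second move, three for the
third). This file lists them one at a time:

* `IsReadingMod P γ h G θ` — the axioms of a regular reading, except that a double point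
  `γ s = γ t` may also be one of the designated pairs, `P s t`;
* `IsRegularReadingOff.isReadingMod` — a reading off a window whose inside double points are
  designated is a reading modulo them; `IsReadingMod.isRegularReading` — once every designated
  pair is a listed chord, the reading is regular;
* `IsReadingMod.insertChord` — **inserting a chord**: if `(po, pu)` is a double point of `γ`
  (`γ po = γ pu`, over-passage `po` higher, sign `ε` read off the determinant) and the merged
  parameters `θ₁` (the old ones renumbered by the double `Fin.succAbove` of
  `GaussDiagram.insertChord`, the new ones at the positions `o` and `o.succAbove u`) are strictly
  increasing within one period, then `θ₁` is a reading modulo `P` of `G.insertChord o u ε`;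
* `GaussDiagram.insertParams` — the merged parameters as a double `Fin.insertNth`, with its
  values (`insertParams_apply_*`) and a criterion for strict monotonicity
  (`strictMono_insertNth`).

Everything is elementary bookkeeping (GPV (2000), §1.2: the Gauss diagram of a generic curve);
no analysis and no named facts.

## References

* M. Goussarov, M. Polyak, O. Viro, *Finite-type invariants of classical and virtual knots*,
  Topology 39 (2000), §1.2 (Gauss diagrams of knot diagrams). [GPV2000]
* M. Polyak, *Minimal generating sets of Reidemeister moves*, Quantum Topol. 1 (2010), §2 (the
  moves as insertions of chords). [Polyak2010]
-/

open Function Set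

noncomputable section

namespace Literature.Topology.FourManifolds

/-! ### Strict monotonicity of an inserted tuple -/

/-- A tuple obtained by inserting the value `x` at position `i` into a strictly increasing tuple
`p` is strictly increasing as soon as `x` exceeds the entries placed before `i` and is exceeded by
the entries placed after `i`. [folklore] -/
theorem strictMono_insertNth {n : ℕ} {i : Fin (n + 1)} {x : ℝ} {p : Fin n → ℝ}
    (hp : StrictMono p) (hlt : ∀ j : Fin n, j.castSucc < i → p j < x)
    (hgt : ∀ j : Fin n, i ≤ j.castSucc → x < p j) :
    StrictMono (i.insertNth (α := fun _ ↦ ℝ) x p) := by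
  intro k l hkl
  rcases Fin.eq_self_or_eq_succAbove i k with hk | ⟨j, hk⟩ <;>
    rcases Fin.eq_self_or_eq_succAbove i l with hl | ⟨j', hl⟩ <;>
    rw [hk, hl] at hkl ⊢
  · exact absurd hkl (lt_irrefl _)
  · rw [Fin.insertNth_apply_same, Fin.insertNth_apply_succAbove]
    exact hgt j' ((Fin.lt_succAbove_iff_le_castSucc i j').1 hkl)
  · rw [Fin.insertNth_apply_same, Fin.insertNth_apply_succAbove]
    exact hlt j ((Fin.succAbove_lt_iff_castSucc_lt i j).1 hkl)
  · rw [Fin.insertNth_apply_succAbove, Fin.insertNth_apply_succAbove]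
    exact hp (Fin.succAbove_lt_succAbove_iff.1 hkl)

namespace GaussDiagram

variable (G : GaussDiagram)

/-- **Merged parameters** after inserting one chord: the old parameters `θ`, renumbered by the
double `Fin.succAbove` of `GaussDiagram.insertChord o u`, together with the parameter `po` of the
new over-passage at position `o` and `pu` of the new under-passage at position `o.succAbove u`.
[folklore] -/
def insertParams (θ : Fin (2 * G.n) → ℝ) (o : Fin (2 * G.n + 2)) (u : Fin (2 * G.n + 1))
    (po pu : ℝ) : Fin (2 * G.n + 2) → ℝ :=
  o.insertNth (α := fun _ ↦ ℝ) po (u.insertNth (α := fun _ ↦ ℝ) pu θ)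

variable (θ : Fin (2 * G.n) → ℝ) (o : Fin (2 * G.n + 2)) (u : Fin (2 * G.n + 1)) (po pu : ℝ)

/-- The new over-passage parameter sits at `o`. [folklore] -/
@[simp] theorem insertParams_apply_over : G.insertParams θ o u po pu o = po := by
  simp [insertParams]

/-- The new under-passage parameter sits at `o.succAbove u`. [folklore] -/
@[simp] theorem insertParams_apply_under : G.insertParams θ o u po pu (o.succAbove u) = pu := by
  simp [insertParams]

/-- The old parameters sit at the doubly renumbered positions. [folklore] -/
@[simp] theorem insertParams_apply_old (q : Fin (2 * G.n)) :
    G.insertParams θ o u po pu (o.succAbove (u.succAbove q)) = θ q := by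
  simp [insertParams]

end GaussDiagram

/-! ### Readings modulo designated double points -/

/-- A **reading modulo the designated pairs `P`** with Gauss diagram `G` and parameters `θ` of a
plane curve `γ` with heights `h`: the axioms of `IsRegularReading γ h G θ`, except that a double
point `γ s = γ t` is trivial (`t ≡ s` modulo `2π`), or a listed chord, OR a designated pair
`P s t` (the double points inside the window of an event, described by the local analysis and
not yet listed). [folklore] -/
structure IsReadingMod (P : ℝ → ℝ → Prop) (γ : ℝ → ℝ × ℝ) (h : ℝ → ℝ) (G : GaussDiagram)
    (θ : Fin (2 * G.n) → ℝ) : Prop where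
  /-- The parameters increase with the position. -/
  strictMono : StrictMono θ
  /-- All parameters lie in one period. -/
  lt_add_two_pi : ∀ i j, θ i < θ j + 2 * Real.pi
  /-- The plane curve is an immersion. -/
  deriv_ne_zero : ∀ t, deriv γ t ≠ 0
  /-- The two passages of a chord project to the same point. -/
  double : ∀ i, γ (θ (G.overPos i)) = γ (θ (G.underPos i))
  /-- The chords and the designated pairs are the only double points modulo the period. -/
  eq_or_crossing_or : ∀ s t, γ s = γ t → (∃ k : ℤ, t = s + k * (2 * Real.pi)) ∨
    (∃ (i : Fin G.n) (k l : ℤ), ({s + k * (2 * Real.pi), t + l * (2 * Real.pi)} : Set ℝ)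
      = {θ (G.overPos i), θ (G.underPos i)}) ∨ P s t
  /-- The over-passage is the higher one. -/
  height_lt : ∀ i, h (θ (G.underPos i)) < h (θ (G.overPos i))
  /-- The sign of a chord is the sign of `det (γ' over, γ' under)`. -/
  sign_eq : ∀ i, (G.sign i : ℤ) = SignType.sign (Matrix.det
    !![(deriv γ (θ (G.overPos i))).1, (deriv γ (θ (G.overPos i))).2;
       (deriv γ (θ (G.underPos i))).1, (deriv γ (θ (G.underPos i))).2])

/-- A reading off a window whose double points inside the window are trivial or designated is a
reading modulo the designated pairs. [folklore] -/
theorem IsRegularReadingOff.isReadingMod {W : Set ℝ} {P : ℝ → ℝ → Prop} {γ : ℝ → ℝ × ℝ}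
    {h : ℝ → ℝ} {G : GaussDiagram} {θ : Fin (2 * G.n) → ℝ} (hr : IsRegularReadingOff W γ h G θ)
    (hW : ∀ s t, s ∈ W → t ∈ W → γ s = γ t → (∃ k : ℤ, t = s + k * (2 * Real.pi)) ∨ P s t) :
    IsReadingMod P γ h G θ :=
  ⟨hr.strictMono, hr.lt_add_two_pi, hr.deriv_ne_zero, hr.double, fun s t hst ↦ by
    rcases hr.eq_or_crossing_or_mem s t hst with h1 | h2 | ⟨hs, ht⟩
    · exact Or.inl h1
    · exact Or.inr (Or.inl h2)
    · exact (hW s t hs ht hst).imp_right Or.inr, hr.height_lt, hr.sign_eq⟩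

/-- A regular reading is a reading modulo any designated pairs. [folklore] -/
theorem IsRegularReading.isReadingMod (P : ℝ → ℝ → Prop) {γ : ℝ → ℝ × ℝ} {h : ℝ → ℝ}
    {G : GaussDiagram} {θ : Fin (2 * G.n) → ℝ} (hr : IsRegularReading γ h G θ) :
    IsReadingMod P γ h G θ :=
  ⟨hr.strictMono, hr.lt_add_two_pi, hr.deriv_ne_zero, hr.double,
    fun s t hst ↦ (hr.eq_or_crossing s t hst).imp_right Or.inl, hr.height_lt, hr.sign_eq⟩

namespace IsReadingMod

variable {P : ℝ → ℝ → Prop} {γ : ℝ → ℝ × ℝ} {h : ℝ → ℝ} {G : GaussDiagram}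
  {θ : Fin (2 * G.n) → ℝ}

/-- **Once every designated pair is a listed chord, the reading is regular.** [folklore] -/
theorem isRegularReading (hr : IsReadingMod P γ h G θ)
    (hP : ∀ s t, P s t → ∃ (i : Fin G.n) (k l : ℤ),
      ({s + k * (2 * Real.pi), t + l * (2 * Real.pi)} : Set ℝ) = {θ (G.overPos i), θ (G.underPos i)}) :
    IsRegularReading γ h G θ :=
  ⟨hr.strictMono, hr.lt_add_two_pi, hr.deriv_ne_zero, hr.double, fun s t hst ↦ by
    rcases hr.eq_or_crossing_or s t hst with h1 | h2 | h3
    · exact Or.inl h1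
    · exact Or.inr h2
    · exact Or.inr (hP s t h3), hr.height_lt, hr.sign_eq⟩

/-- Weakening the designated pairs. [folklore] -/
theorem mono {Q : ℝ → ℝ → Prop} (hr : IsReadingMod P γ h G θ) (hPQ : ∀ s t, P s t → Q s t) :
    IsReadingMod Q γ h G θ :=
  ⟨hr.strictMono, hr.lt_add_two_pi, hr.deriv_ne_zero, hr.double,
    fun s t hst ↦ (hr.eq_or_crossing_or s t hst).imp_right (Or.imp_right (hPQ s t)),
    hr.height_lt, hr.sign_eq⟩

/-- **Inserting a chord into a reading.** Let `θ` read `G` modulo `P` on `(γ, h)`, and let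
`(po, pu)` be a further double point of `γ` — `γ po = γ pu`, the passage at `po` higher, `ε` the
sign of `det (γ' po, γ' pu)`. If parameters `θ₁ : Fin (2n + 2) → ℝ`, strictly increasing within
one period, carry `po` at position `o`, `pu` at position `o.succAbove u` and the old parameter of
position `q` at `o.succAbove (u.succAbove q)` (e.g. `θ₁ = G.insertParams θ o u po pu`), then `θ₁`
reads `G.insertChord o u ε` modulo `P` (the new chord has index `Fin.last n`). GPV (2000), §1.2;
Polyak (2010), §2. [cite: GPV2000, §1.2] -/
theorem insertChord (hr : IsReadingMod P γ h G θ) (o : Fin (2 * G.n + 2)) (u : Fin (2 * G.n + 1))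
    {ε : ℤˣ} {po pu : ℝ} {θ₁ : Fin (2 * G.n + 2) → ℝ} (hmono : StrictMono θ₁)
    (hwin : ∀ i j, θ₁ i < θ₁ j + 2 * Real.pi) (hθo : θ₁ o = po) (hθu : θ₁ (o.succAbove u) = pu)
    (hθq : ∀ q, θ₁ (o.succAbove (u.succAbove q)) = θ q) (hdouble : γ po = γ pu)
    (hheight : h pu < h po)
    (hsign : (ε : ℤ) = SignType.sign (Matrix.det
      !![(deriv γ po).1, (deriv γ po).2; (deriv γ pu).1, (deriv γ pu).2])) :
    IsReadingMod P γ h (G.insertChord o u ε) θ₁ := by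
  refine ⟨hmono, hwin, hr.deriv_ne_zero, fun i ↦ ?_, fun s t hst ↦ ?_, fun i ↦ ?_, fun i ↦ ?_⟩
  · -- double
    induction i using Fin.lastCases with
    | last =>
      rw [GaussDiagram.insertChord_overPos_last, GaussDiagram.insertChord_underPos_last, hθo, hθu]
      exact hdouble
    | cast i =>
      rw [GaussDiagram.insertChord_overPos_castSucc, GaussDiagram.insertChord_underPos_castSucc,
        hθq, hθq]
      exact hr.double i
  · -- double points: old chords keep their parameters
    rcases hr.eq_or_crossing_or s t hst with h1 | ⟨i, k, l, hset⟩ | h3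
    · exact Or.inl h1
    · refine Or.inr (Or.inl ⟨i.castSucc, k, l, ?_⟩)
      rw [GaussDiagram.insertChord_overPos_castSucc, GaussDiagram.insertChord_underPos_castSucc,
        hθq, hθq]
      exact hset
    · exact Or.inr (Or.inr h3)
  · -- heights
    induction i using Fin.lastCases with
    | last =>
      rw [GaussDiagram.insertChord_overPos_last, GaussDiagram.insertChord_underPos_last, hθo, hθu]
      exact hheight
    | cast i =>
      rw [GaussDiagram.insertChord_overPos_castSucc, GaussDiagram.insertChord_underPos_castSucc,
        hθq, hθq]
      exact hr.height_lt i
  · -- signs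
    induction i using Fin.lastCases with
    | last =>
      rw [GaussDiagram.insertChord_sign_last, GaussDiagram.insertChord_overPos_last,
        GaussDiagram.insertChord_underPos_last, hθo, hθu]
      exact hsign
    | cast i =>
      rw [GaussDiagram.insertChord_sign_castSucc, GaussDiagram.insertChord_overPos_castSucc,
        GaussDiagram.insertChord_underPos_castSucc, hθq, hθq]
      exact hr.sign_eq i

/-- The designated pair just inserted may be dropped from the designation: after
`insertChord`, a double point congruent to `{po, pu}` is the listed chord `Fin.last n`.
[folklore] -/
theorem insertChord_drop (hr : IsReadingMod P γ h G θ) (o : Fin (2 * G.n + 2))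
    (u : Fin (2 * G.n + 1)) {ε : ℤˣ} {po pu : ℝ} {θ₁ : Fin (2 * G.n + 2) → ℝ}
    (hmono : StrictMono θ₁) (hwin : ∀ i j, θ₁ i < θ₁ j + 2 * Real.pi) (hθo : θ₁ o = po)
    (hθu : θ₁ (o.succAbove u) = pu) (hθq : ∀ q, θ₁ (o.succAbove (u.succAbove q)) = θ q)
    (hdouble : γ po = γ pu) (hheight : h pu < h po)
    (hsign : (ε : ℤ) = SignType.sign (Matrix.det
      !![(deriv γ po).1, (deriv γ po).2; (deriv γ pu).1, (deriv γ pu).2]))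
    {Q : ℝ → ℝ → Prop}
    (hPQ : ∀ s t, P s t → Q s t ∨ ∃ k l : ℤ,
      ({s + k * (2 * Real.pi), t + l * (2 * Real.pi)} : Set ℝ) = {po, pu}) :
    IsReadingMod Q γ h (G.insertChord o u ε) θ₁ := by
  have h1 := hr.insertChord o u hmono hwin hθo hθu hθq hdouble hheight hsign (ε := ε)
  refine ⟨h1.strictMono, h1.lt_add_two_pi, h1.deriv_ne_zero, h1.double, fun s t hst ↦ ?_,
    h1.height_lt, h1.sign_eq⟩
  rcases h1.eq_or_crossing_or s t hst with e1 | e2 | e3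
  · exact Or.inl e1
  · exact Or.inr (Or.inl e2)
  · rcases hPQ s t e3 with q | ⟨k, l, hkl⟩
    · exact Or.inr (Or.inr q)
    · refine Or.inr (Or.inl ⟨Fin.last G.n, k, l, ?_⟩)
      rw [GaussDiagram.insertChord_overPos_last, GaussDiagram.insertChord_underPos_last, hθo, hθu]
      exact hkl

end IsReadingMod

end Literature.Topology.FourManifolds
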